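import Literature.NumberTheory.Automorphic.AutomorphicRepsGLOneLine
import Literature.NumberTheory.Automorphic.ArchParameterUnique
import Literature.NumberTheory.Automorphic.HarishChandraGLEmbeddings
import Literature.NumberTheory.Automorphic.AutomorphicRepLieActionGL
import HarnessLib

/-!
# The archimedean (Harish-Chandra) parameter of an automorphic representation of `GL₁(𝔸_K)`

Topic `NumberTheory/Automorphic`; proof file (theorems only: no definition, no named fact, no
instance), second step (after `AutomorphicRepsGLOneLine`) of the rank-one case of the named fact
`ArthurClozel1989_strongLifting_archimedean` (`BaseChangeArchimedean`; Arthur–Clozel (1989), Ch. 3,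
Thm. 5.1 with Ch. 1 §7). Vocabulary: `HasHCParameter`, `HarishChandraHomGL`, `IsHighestWeightVector`
(`HarishChandraGL`), the `τ`-projectors `HCEmb.proj` (`HarishChandraGLEmbeddings`),
`AutomorphicRepData.HasArchParameter` (`AutomorphicRepsGL`), `AutomorphicRepData.HasLieAction`.

Since `W / W'` is a line for every automorphic representation `π = W / W'` of `GL₁(𝔸_K)`
(`AutomorphicRepData.finrank_quot_glOne`), the Lie algebra `𝔤 = 𝔤𝔩₁(K_∞)` acts on it through a
real linear form `d : 𝔤 → ℂ` (`AutomorphicRepData.exists_linearMap_lieAction_eq_smul_one_glOne`),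
and the Harish-Chandra parameter of `π` at every complex embedding is read off `d`:

* `hasHCParameter_glOne_of_eq_smul_one` — **a `𝔤𝔩₁(𝕜)`-module on which `𝔤𝔩₁(𝕜) = 𝕜` acts by
  scalars `a ↦ L(a)` (`L` real linear, `𝕜 = ℝ` or `ℂ`) has Harish-Chandra parameter
  `τ ↦ {proj L τ 1}`**, i.e. `{L(1)}` for `𝕜 = ℝ` and `{½(L(1) ∓ i L(i))}` at `τ = id, conj` for
  `𝕜 = ℂ` — the `τ`-components of the complex-linear extension of `L` (for `L` the differential of
  `z ↦ z^p z̄^q`: `p` and `q`). For `n = 1`, `ρ = 0` and `𝔫 = 0`, so every non-zero vector is a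
  highest weight vector of weight `l_τ = proj L τ 1` (`∑_τ τ(a) l_τ = L(a)`, `HCEmb.sum_proj`,
  `proj_smul`), and the highest-weight axiom of every Harish-Chandra homomorphism `γ` gives the
  central character `z ↦ γ(z)(l + ρ) = γ(z)(l)`. Knapp (2002), Thm. 5.44 (degenerate case
  `n = 1`); Clozel (1990), §3.3; Buzzard–Gee (2014), §3.1.
* `exists_linearMap_eq_smul_one_of_finrank_eq_one` — endomorphisms of a line are scalars, linearly.
* `AutomorphicRepData.hasArchParameter_glOne_of_eq_smul_one` — **the archimedean parameter of an
  automorphic representation of `GL₁(𝔸_K)`**: if `𝔤` acts on `W / W'` through the real linear form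
  `d`, then `χ` is an archimedean parameter of `π` as soon as `χ(σ_w) = {d(1_w)}` at each real place
  `w` and `χ(τ ∘ σ_w) = {proj (a ↦ d(a_w)) τ 1}` at each complex place `w` (`1_w`, `a_w`: the
  element of `𝔤𝔩₁(K_∞)` which is `1`, resp. `a ∈ ℂ`, at `w` and `0` elsewhere); with
  `AutomorphicRepData.hasArchParameter_unique` this determines the parameter, and
  `AutomorphicRepData.exists_hasArchParameter_glOne` records that one exists.

## References

* A. W. Knapp, *Lie Groups Beyond an Introduction*, 2nd ed. (2002), §V.5, Thm. 5.44 [Knapp2002].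
* L. Clozel, *Motifs et formes automorphes* (1990), §3.3 [Clozel1990].
* K. Buzzard, T. Gee, *The conjectural connections between automorphic representations and Galois
  representations* (2014), §3.1 [BuzzardGee2014].
* J. Arthur, L. Clozel, Ann. of Math. Stud. 120 (1989), Ch. 1 §7, Ch. 3 Thm. 5.1 [ArthurClozelAMS120].
-/

-- Mathlib idiom (Mathlib/Algebra/Lie/OfAssociative.lean); needed to mention Lie algebra
-- representations `𝔤 →ₗ⁅ℝ⁆ End V` on matrix algebras and endomorphism rings
attribute [local instance 100] LieRing.ofAssociativeRing

noncomputable section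

open scoped Matrix Classical ComplexConjugate
open NumberField NumberField.InfinitePlace NumberField.mixedEmbedding

namespace Literature.NumberTheory.Automorphic

/-! ### Endomorphisms of a line -/

section Line

/-- **Endomorphisms of a line are scalars, linearly in any parameter**: if `dim_ℂ V = 1` and
`f : M → End_ℂ V` is real linear, then `f X = d(X) · 1` for a real linear form `d : M → ℂ`.
[folklore] -/
theorem exists_linearMap_eq_smul_one_of_finrank_eq_one {M : Type*} [AddCommGroup M] [Module ℝ M]
    {V : Type*} [AddCommGroup V] [Module ℂ V] (hV : Module.finrank ℂ V = 1)
    (f : M →ₗ[ℝ] Module.End ℂ V) :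
    ∃ d : M →ₗ[ℝ] ℂ, ∀ X, f X = d X • (1 : Module.End ℂ V) := by
  obtain ⟨e⟩ := Module.nonempty_linearEquiv_of_finrank_eq_one hV
  -- `e : ℂ ≃ V`; every endomorphism `g` is the scalar `e⁻¹ (g (e 1))`
  have key : ∀ g : Module.End ℂ V, g = (e.symm (g (e 1))) • (1 : Module.End ℂ V) := by
    intro g
    refine LinearMap.ext fun v => ?_
    have hv : v = (e.symm v) • e 1 := by
      rw [← map_smul, smul_eq_mul, mul_one, LinearEquiv.apply_symm_apply]
    rw [LinearMap.smul_apply, Module.End.one_apply]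
    conv_lhs => rw [hv, map_smul]
    conv_rhs => rw [hv]
    rw [smul_smul, mul_comm, ← smul_smul]
    congr 1
    rw [← map_smul, smul_eq_mul, mul_one, LinearEquiv.apply_symm_apply]
  refine ⟨((e.symm : V →ₗ[ℂ] ℂ).restrictScalars ℝ).comp
      (((LinearMap.applyₗ (e 1) : Module.End ℂ V →ₗ[ℂ] V)).restrictScalars ℝ ∘ₗ f), fun X => ?_⟩
  exact key (f X)

end Line

/-! ### Harish-Chandra parameters of `𝔤𝔩₁(𝕜)`-modules on which `𝔤𝔩₁(𝕜)` acts by scalars -/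

section GLOneHC

variable {𝕜 : Type*} [RCLike 𝕜]

/-- A `1 × 1` matrix is the scalar matrix of its entry. [folklore] -/
theorem matrix_fin_one_eq_smul_one (X : Matrix (Fin 1) (Fin 1) 𝕜) :
    X = X 0 0 • (1 : Matrix (Fin 1) (Fin 1) 𝕜) := by
  refine Matrix.ext fun i j => ?_
  rw [Subsingleton.elim i 0, Subsingleton.elim j 0]
  simp

/-- `ρ_{GL(1)} = 0`: half the sum of the positive roots of `𝔤𝔩₁` vanishes. [folklore] -/
theorem rhoGL_one (i : Fin 1) : rhoGL 1 i = 0 := by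
  rw [Subsingleton.elim i 0]
  simp [rhoGL]

open RCLike in
/-- **Harish-Chandra parameter of a scalar `𝔤𝔩₁(𝕜)`-module.** Let `𝔤𝔩₁(𝕜) = 𝕜` (`𝕜 = ℝ` or `ℂ`)
act on the non-zero complex vector space `V` by scalars, `a ↦ L(a) · 1` with `L : 𝕜 → ℂ` real
linear. Then `V` has Harish-Chandra parameter `τ ↦ {proj L τ 1}` — `{L(1)}` for `𝕜 = ℝ`, and
`{½ (L 1 - i L i)}` at `τ = id`, `{½ (L 1 + i L i)}` at `τ = conj` for `𝕜 = ℂ`. For `n = 1` the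
nilpotent radical is `0` and `ρ = 0`, so every non-zero vector is a highest weight vector of weight
`l_τ = proj L τ 1` (`L(a) = ∑_τ τ(a) l_τ`), on which `z ∈ Z(𝔤)` acts by `γ(z)(l)` for every
Harish-Chandra homomorphism `γ`. Knapp (2002), §V.5, Thm. 5.44; Clozel (1990), §3.3.
[cite: Knapp2002, §V.5 Thm. 5.44] -/
theorem hasHCParameter_glOne_of_eq_smul_one {V : Type} [AddCommGroup V] [Module ℂ V] [Nontrivial V]
    (ρ : Matrix (Fin 1) (Fin 1) 𝕜 →ₗ⁅ℝ⁆ Module.End ℂ V) (L : 𝕜 →ₗ[ℝ] ℂ)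
    (hρ : ∀ a : 𝕜, ρ (a • (1 : Matrix (Fin 1) (Fin 1) 𝕜)) = L a • (1 : Module.End ℂ V)) :
    HasHCParameter ρ fun τ => {HCEmb.proj L τ 1} := by
  -- the weight `l` and the evaluation point `l + ρ = l`
  set l : ArchWeightGL 𝕜 1 := fun τ _ => HCEmb.proj L τ 1 with hl
  set pt : (𝕜 →ₐ[ℝ] ℂ) × Fin 1 → ℂ := fun p => l p.1 p.2 + rhoGL 1 p.2 with hpt
  have hLsum : ∀ a : 𝕜, L a = ∑ τ : 𝕜 →ₐ[ℝ] ℂ, τ a * HCEmb.proj L τ 1 := by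
    intro a
    have h := HCEmb.sum_proj (𝕜 := 𝕜) L.toAddMonoidHom a
    rw [LinearMap.toAddMonoidHom_coe] at h
    rw [← h]
    refine Finset.sum_congr rfl fun τ _ => ?_
    have := HCEmb.proj_smul L τ a (1 : 𝕜)
    rw [smul_eq_mul, mul_one] at this
    rw [this, smul_eq_mul]
  -- every non-zero vector is a highest weight vector of weight `l`
  have hw : ∀ v : V, v ≠ 0 → IsHighestWeightVector ρ l v := by
    intro v hv
    refine ⟨hv, fun X hX => ?_, fun h => ?_⟩
    · have hX0 : X = 0 := by
        rw [matrix_fin_one_eq_smul_one X, (mem_upperNilpLie_iff 𝕜 1 X).mp hX 0 0 le_rfl, zero_smul]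
      rw [hX0, map_zero, LinearMap.zero_apply]
    · have hdiag : Matrix.diagonal h = h 0 • (1 : Matrix (Fin 1) (Fin 1) 𝕜) := by
        rw [matrix_fin_one_eq_smul_one (Matrix.diagonal h), Matrix.diagonal_apply_eq]
      rw [hdiag, hρ, LinearMap.smul_apply, Module.End.one_apply, hLsum]
      congr 1
      simp only [weightFun, hl, Fin.sum_univ_one]
      exact Finset.sum_congr rfl fun τ _ => mul_comm _ _
  obtain ⟨v₀, hv₀⟩ := exists_ne (0 : V)
  -- the central character, written with the Harish-Chandra homomorphism of the tree
  let θ : Subalgebra.center ℝ (UniversalEnvelopingAlgebra ℝ (Matrix (Fin 1) (Fin 1) 𝕜)) →ₐ[ℝ] ℂ :=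
    ((MvPolynomial.aeval pt).restrictScalars ℝ).comp (harishChandraHomGL 𝕜 1).toAlgHom
  have hθ : ∀ (z : Subalgebra.center ℝ (UniversalEnvelopingAlgebra ℝ (Matrix (Fin 1) (Fin 1) 𝕜)))
      (v : V), UniversalEnvelopingAlgebra.lift ℝ ρ
        (z : UniversalEnvelopingAlgebra ℝ (Matrix (Fin 1) (Fin 1) 𝕜)) v = θ z • v := by
    intro z v
    by_cases hv : v = 0
    · rw [hv, map_zero, smul_zero]
    · exact (harishChandraHomGL 𝕜 1).highestWeight V ρ l v (hw v hv) z
  refine ⟨fun τ => Multiset.card_singleton _, θ, fun z => LinearMap.ext fun v => ?_, fun γ l' hl' z => ?_⟩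
  · rw [hθ, Module.algebraMap_end_apply]
  · -- compare with `γ` on the highest weight vector `v₀`
    have h₁ := γ.highestWeight V ρ l v₀ (hw v₀ hv₀) z
    rw [hθ] at h₁
    have h₂ : θ z = MvPolynomial.aeval pt (γ.toAlgHom z) := smul_left_injective ℂ hv₀ h₁
    have hfun : (fun p : (𝕜 →ₐ[ℝ] ℂ) × Fin 1 => l' p.1 p.2) = pt := by
      funext p
      obtain ⟨τ, i⟩ := p
      rw [Subsingleton.elim i 0]
      have hli : l' τ 0 = HCEmb.proj L τ 1 := by
        have := hl' τ
        dsimp only at this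
        rw [Finset.univ_unique, Fin.default_eq_zero, Finset.singleton_val, Multiset.map_singleton,
          Multiset.singleton_inj] at this
        exact this
      simp only [hpt, hl, rhoGL_one, add_zero, hli]
    rw [h₂, hfun]

end GLOneHC

/-! ### The archimedean parameter of an automorphic representation of `GL₁(𝔸_K)` -/

section GLOne

variable {K : Type} [Field K] [NumberField K] {hcpt : isCompact_glFiniteIntegralLevel 1 K}

/-- **`𝔤𝔩₁(K_∞)` acts on `W / W'` through a real linear form**: for an automorphic representation
`π = W / W'` of `GL₁(𝔸_K)` and its Lie algebra action `ρ𝔤` (any map satisfying `HasLieAction`, or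
indeed any real linear map into `End (W / W')`), `ρ𝔤 X = d(X) · 1` for a real linear
`d : 𝔤𝔩₁(K_∞) → ℂ`, because `W / W'` is a line (`finrank_quot_glOne`). Gelbart (1975), §2.A.
[folklore] -/
theorem AutomorphicRepData.exists_linearMap_lieAction_eq_smul_one_glOne
    (π : AutomorphicRepData (AutomorphyDatum.gl 1 K hcpt))
    (ρ𝔤 : (AutomorphyDatum.gl 1 K hcpt).arch.lie →ₗ⁅ℝ⁆ Module.End ℂ π.Quot) :
    ∃ d : (AutomorphyDatum.gl 1 K hcpt).arch.lie →ₗ[ℝ] ℂ, ∀ X, ρ𝔤 X = d X • (1 : Module.End ℂ π.Quot) :=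
  exists_linearMap_eq_smul_one_of_finrank_eq_one π.finrank_quot_glOne ρ𝔤.toLinearMap

/-- **The archimedean parameter of an automorphic representation of `GL₁(𝔸_K)`.** Let `π = W / W'`
be an automorphic representation of `GL₁(𝔸_K)` (Borel–Jacquet), `ρ𝔤` its Lie algebra action on
the line `W / W'`, acting through the real linear form `d` (`ρ𝔤 X = d(X) · 1`). A family
`χ : (K →+* ℂ) → Multiset ℂ` is an archimedean parameter of `π` as soon as
`χ(σ_w) = {d(1_w)}` for every real place `w` (`1_w ∈ 𝔤𝔩₁(K_∞)` the unit at `w`) and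
`χ(τ ∘ σ_w) = {proj (a ↦ d(a_w)) τ 1}` for every complex place `w` and `τ ∈ {id, conj}`
(`a_w ∈ 𝔤𝔩₁(K_∞)`: `a ∈ ℂ = K_w` at `w`, `0` elsewhere), i.e. `χ(σ_w) = {½ (d(1_w) - i d(i_w))}`,
`χ(σ̄_w) = {½ (d(1_w) + i d(i_w))}` — for `π_w = (z ↦ z^p z̄^q)`, `{p}` and `{q}`. (By
`hasArchParameter_unique` this is the only parameter.) Clozel (1990), §3.3; Knapp (2002),
Thm. 5.44; Arthur–Clozel (1989), Ch. 1 §7 (the archimedean parameters entering base change for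
`GL(1)`). [cite: Clozel1990, §3.3] -/
theorem AutomorphicRepData.hasArchParameter_glOne_of_eq_smul_one
    (π : AutomorphicRepData (AutomorphyDatum.gl 1 K hcpt))
    {ρ𝔤 : (AutomorphyDatum.gl 1 K hcpt).arch.lie →ₗ⁅ℝ⁆ Module.End ℂ π.Quot} (hρ : π.HasLieAction ρ𝔤)
    (d : (AutomorphyDatum.gl 1 K hcpt).arch.lie →ₗ[ℝ] ℂ)
    (hd : ∀ X, ρ𝔤 X = d X • (1 : Module.End ℂ π.Quot))
    {χ : (K →+* ℂ) → Multiset ℂ}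
    (hre : ∀ w : {w : InfinitePlace K // w.IsReal},
      χ w.1.embedding = {d ⟨realPlaceLie 1 w 1, trivial⟩})
    (hco : ∀ (w : {w : InfinitePlace K // w.IsComplex}) (τ : ℂ →ₐ[ℝ] ℂ),
      χ (τ.toRingHom.comp w.1.embedding) =
        {HCEmb.proj (fun a : ℂ => d ⟨complexPlaceLie 1 w (a • (1 : Matrix (Fin 1) (Fin 1) ℂ)), trivial⟩)
          τ 1}) :
    π.HasArchParameter χ := by
  haveI : Nontrivial π.Quot := π.nontrivial_quot
  refine ⟨ρ𝔤, hρ, fun w => ?_, fun w => ?_⟩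
  · -- real place `w`
    let L : ℝ →ₗ[ℝ] ℂ := d ∘ₗ
      ((LieSubalgebra.topEquiv.symm : Matrix (Fin 1) (Fin 1) (mixedSpace K) ≃ₗ⁅ℝ⁆
          (⊤ : LieSubalgebra ℝ (Matrix (Fin 1) (Fin 1) (mixedSpace K)))).toLinearMap ∘ₗ
        (realPlaceLie 1 w).toLinearMap ∘ₗ
          (LinearMap.toSpanSingleton ℝ (Matrix (Fin 1) (Fin 1) ℝ) 1))
    have hL : ∀ a : ℝ, L a = d ⟨realPlaceLie 1 w (a • (1 : Matrix (Fin 1) (Fin 1) ℝ)), trivial⟩ :=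
      fun a => rfl
    have h := hasHCParameter_glOne_of_eq_smul_one
      ((ρ𝔤.comp (LieSubalgebra.topEquiv :
        (⊤ : LieSubalgebra ℝ (Matrix (Fin 1) (Fin 1) (mixedSpace K))) ≃ₗ⁅ℝ⁆
          Matrix (Fin 1) (Fin 1) (mixedSpace K)).symm.toLieHom).comp (realPlaceLie 1 w)) L
      (fun a => by rw [hL]; exact hd _)
    convert h using 2 with τ
    rw [hre w]
    congr 1
    rw [HCEmb.proj_def, HCEmb.card_algHom_of_I_eq_zero RCLike.I_to_real, RCLike.I_to_real]
    simp only [zero_smul, map_zero, smul_zero, add_zero, Nat.cast_one, inv_one, one_smul]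
    rw [hL, one_smul]
  · -- complex place `w`
    let L : ℂ →ₗ[ℝ] ℂ := d ∘ₗ
      ((LieSubalgebra.topEquiv.symm : Matrix (Fin 1) (Fin 1) (mixedSpace K) ≃ₗ⁅ℝ⁆
          (⊤ : LieSubalgebra ℝ (Matrix (Fin 1) (Fin 1) (mixedSpace K)))).toLinearMap ∘ₗ
        (complexPlaceLie 1 w).toLinearMap ∘ₗ
          ((LinearMap.toSpanSingleton ℂ (Matrix (Fin 1) (Fin 1) ℂ) 1).restrictScalars ℝ))
    have hL : ∀ a : ℂ, L a = d ⟨complexPlaceLie 1 w (a • (1 : Matrix (Fin 1) (Fin 1) ℂ)), trivial⟩ :=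
      fun a => rfl
    have h := hasHCParameter_glOne_of_eq_smul_one
      ((ρ𝔤.comp (LieSubalgebra.topEquiv :
        (⊤ : LieSubalgebra ℝ (Matrix (Fin 1) (Fin 1) (mixedSpace K))) ≃ₗ⁅ℝ⁆
          Matrix (Fin 1) (Fin 1) (mixedSpace K)).symm.toLieHom).comp (complexPlaceLie 1 w)) L
      (fun a => by rw [hL]; exact hd _)
    convert h using 2 with τ
    rw [hco w τ]
    rfl

/-- **Every automorphic representation of `GL₁(𝔸_K)` has an archimedean parameter** (namely the
one of `hasArchParameter_glOne_of_eq_smul_one`, read off the real linear form through which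
`𝔤𝔩₁(K_∞)` acts on the line `W / W'`). Clozel (1990), §3.3; Borel–Jacquet (1979), 4.6.
[cite: Clozel1990, §3.3] -/
theorem AutomorphicRepData.exists_hasArchParameter_glOne
    (π : AutomorphicRepData (AutomorphyDatum.gl 1 K hcpt)) :
    ∃ χ : (K →+* ℂ) → Multiset ℂ, π.HasArchParameter χ := by
  obtain ⟨ρ𝔤, hρ⟩ := π.exists_hasLieAction_gl
  obtain ⟨d, hd⟩ := π.exists_linearMap_lieAction_eq_smul_one_glOne ρ𝔤
  -- the parameter, embedding by embedding
  let F : {w : InfinitePlace K // w.IsComplex} → ℂ → ℂ := fun w a =>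
    d ⟨complexPlaceLie 1 w (a • (1 : Matrix (Fin 1) (Fin 1) ℂ)), trivial⟩
  let χ : (K →+* ℂ) → Multiset ℂ := fun σ =>
    if hw : (InfinitePlace.mk σ).IsReal then {d ⟨realPlaceLie 1 ⟨InfinitePlace.mk σ, hw⟩ 1, trivial⟩}
    else {HCEmb.proj (F ⟨InfinitePlace.mk σ, not_isReal_iff_isComplex.mp hw⟩)
      (if σ = (InfinitePlace.mk σ).embedding then AlgHom.id ℝ ℂ else Complex.conjAe) 1}
  refine ⟨χ, π.hasArchParameter_glOne_of_eq_smul_one hρ d hd (fun w => ?_) (fun w τ => ?_)⟩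
  · have hw : (InfinitePlace.mk w.1.embedding).IsReal := by rw [mk_embedding]; exact w.2
    have e : (⟨InfinitePlace.mk w.1.embedding, hw⟩ : {w : InfinitePlace K // w.IsReal}) = w :=
      Subtype.ext (mk_embedding w.1)
    simp only [χ, dif_pos hw]
    rw [e]
  · have hid : (AlgHom.id ℝ ℂ).toRingHom.comp w.1.embedding = w.1.embedding :=
      algHomId_toRingHom_comp _
    have hconj : (Complex.conjAe : ℂ →ₐ[ℝ] ℂ).toRingHom.comp w.1.embedding =
        ComplexEmbedding.conjugate w.1.embedding := conjAe_toRingHom_comp _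
    have hne : ComplexEmbedding.conjugate w.1.embedding ≠ w.1.embedding := fun h =>
      (InfinitePlace.isComplex_iff.mp w.2) (ComplexEmbedding.isReal_iff.mpr h)
    have hσ : InfinitePlace.mk (τ.toRingHom.comp w.1.embedding) = w.1 := by
      rcases Complex.real_algHom_eq_id_or_conj τ with h | h
      · rw [h, hid, mk_embedding]
      · rw [h, hconj, mk_conjugate_eq, mk_embedding]
    have hw : ¬ (InfinitePlace.mk (τ.toRingHom.comp w.1.embedding)).IsReal := by
      rw [hσ, not_isReal_iff_isComplex]; exact w.2
    have e : (⟨InfinitePlace.mk (τ.toRingHom.comp w.1.embedding), not_isReal_iff_isComplex.mp hw⟩ :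
        {w : InfinitePlace K // w.IsComplex}) = w := Subtype.ext hσ
    simp only [χ, dif_neg hw]
    rw [e, hσ]
    rcases Complex.real_algHom_eq_id_or_conj τ with h | h
    · subst h
      rw [hid, if_pos rfl]
    · subst h
      rw [hconj, if_neg hne]

end GLOne

end Literature.NumberTheory.Automorphic
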